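import Summits.BirchSwinnertonDyer.Rank1Residual.X10.CoreTheoremAOddPrimeHolds
import HarnessLib

/-!
# Route `ErratumRoadFive` (rung K2), crux 6 `NonSurjCorner` (item stmt-BirchSwinnertonDyer-19065), the twin summand:
# the CORE of the Kato `μ`-transfer WITHOUT big image holds at EVERY odd prime with NO HYPOTHESIS ON THE REDUCTION
# AT `p` — rung K6's `X10.CoreTheoremAOddPrime` with its two inert good-ordinary binders removed
# (cell `bsd-stepL`, seat `bsd-stepL-corner-p1` g6; `--supports stmt-BirchSwinnertonDyer-19065`)

WHY. The corner's twin summand (`NonSurjCornerTwinMu`: Greenberg's `μ = 0` for the cyclotomic Selmer dual of a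
rank-0 twist `E^d` with `E^d[p]` irreducible, `ρ̄` NOT onto, `p ∈ {5,7}` of MULTIPLICATIVE reduction) is the exact
analogue at `p ∥ N` of rung K6's `MuTransfer` conclusion, which the cells `bsd-smallim` ∕ `b2b-bsdres` have
KERNEL-CHECKED at good ordinary `p` modulo Kato's zeta-element package F1 (`X10.mu_eq_zero_of_fine`, p480380;
`Theorems.smallImageMuTransfer_MuTransfer_of_fine`, p482919). Its heart, N2's typed node `X10.CoreTheoremAOddPrime`
(«a GENUINE Λ-adic Euler-system class `s ∉ p𝐇¹` forces a power of `T = conj_γ − 1` to kill every `E[p]`-lift of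
`Sel₀(ℚ_∞, E[p^∞])`»), is proved by `CoreAssembly.coreOdd_of_selmerDual_of_stepsTwoFour` (k6-c2 g3, file
`Theorems/SmallImageMuTransferMuTransferX9CoreAssemblyOdd.lean`) whose statement carries `W.HasGoodReductionAtPrime p`
and `p ∤ a_p` but whose PROOF NEVER USES THEM (its first line is `intro W _ _ p _ _ _ _ κ γ I hp2 _ _ hirr hns hκ hγ hs`;
its docstring: «good, ordinary — the last two inert»): the fine Selmer group `Sel₀` has the ZERO local condition at
`p`, the Kolyvagin-system argument runs at tame primes `q ≠ p`, and the inputs — `SelmerDual.stub_selmerDualOdd_holds`,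
`TameClass.stub_stepsTwoFourOdd_holds`, Kato §13.8 (`Kato2004.mem_pSmul_of_red_eq_zero_of_integral_of_smul_mem` fed by
`UniversalNorms.mem_integralH1_of_layerCores_eq_of_smul_mem`), Poitou–Tate over `ℚ` and Tate's local Euler–Poincaré
characteristic — are all reduction-free TREE THEOREMS. This file records that fact as a theorem:

* `CoreAssembly.coreOdd_anyReduction_of_selmerDual_of_stepsTwoFour` — VERBATIM the statement and proof of
  `coreOdd_of_selmerDual_of_stepsTwoFour` with the two inert binders deleted (the proof term is copied, not
  re-derived: a theorem with an uninhabitable-at-`p ∥ N` hypothesis cannot be instantiated, so the binder-free form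
  must be re-elaborated once);
* `CoreAssembly.coreOdd_anyReduction_holds` — the same with the five inputs DISCHARGED by the tree theorems above:
  for EVERY globally minimal elliptic `W/ℚ`, EVERY odd prime `p` (good, multiplicative or additive), `E[p]` irreducible,
  `ρ̄` not onto, cyclotomic `(κ, γ)` and pin `I`: a genuine Euler-system class outside `p𝐇¹` kills `Sel₀[p]`'s
  `T`-divisible growth. This is the input of the corner's `μ`-transfer at a multiplicative prime
  (`Theorems/ErratumRoadFiveNonSurjCornerMuTransferMult.lean`, this seat).

HONEST FRAMING: two theorems, no definition, no named fact, no `sorry`; the mathematics and the proof text are the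
K6 cells' (MU-TRANSFER-PROOF §§0–5, KOLY-MEMO Thm. 5.7.1; credited above) — this file only removes two unused
hypotheses; nothing is asserted about any curve; nothing is booked; BSD is not advanced; no census word moves (T7).
PARTITION (D-0054): X11b@p≥5 (B9 ∕ N8) × T4′ corner twin summand | O2@3 × T4″ twin — types-the-object-of; closes none.

References: [Kato2004Asterisque] §13.3, §13.8 (pp. 228–229), Thm. 12.4, Lemma 8.5 (2); [MazurRubin2004] Prop. 1.3.2,
§4.4, §5.3; [MilneADT2006] I Thm. 2.8, Thm. 4.10 (b); [SilvermanAEC2009] III.8.1; tree: `X10/CoreTheoremAOddPrime*.lean`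
(b2b x10 GEN 37–40), `Theorems/SmallImageMuTransferMuTransferX9CoreAssemblyOdd.lean` (bsd-smallim k6-c2 g3),
HOME/pub/bsd-smallim/koly/MU-TRANSFER-PROOF.md §§0–5.
-/

set_option linter.dupNamespace false
set_option autoImplicit false

noncomputable section

open scoped Classical NumberField
open WeierstrassCurve Field IsDedekindDomain
open Literature.NumberTheory.GaloisRepresentations
open Literature.NumberTheory.GaloisCohomology
open Literature.NumberTheory.EllipticCurves
open Literature.NumberTheory.EllipticCurves.Kato2004
open Literature.NumberTheory.EllipticCurves.Kato2004.EulerSystemValues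
open Summit.BirchSwinnertonDyer.BirchSwinnertonDyer.Rank1Residual

namespace Summit.BirchSwinnertonDyer.BirchSwinnertonDyer.Rank1Residual.CoreAssembly

/-- **The core of the `μ`-transfer at every ODD prime, class-free AND REDUCTION-FREE, from the two (landed) stubs
of K6's skeleton v6 and three published facts** — verbatim `coreOdd_of_selmerDual_of_stepsTwoFour` (k6-c2 g3) with
the inert binders `W.HasGoodReductionAtPrime p`, `p ∤ a_p` deleted from the conclusion; the proof text is copied
unchanged (MU-TRANSFER-PROOF §5: Step 0 → level `e = p^n` → bad class `y` → `Ψ` → truncation → joint value →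
Step 2 Frobenius → Steps 3–4 reciprocity → the count → contradiction). `hred`: Kato §13.8; `hPT`: Poitou–Tate over
`ℚ`; `hEP`: local Euler–Poincaré characteristic; `hG1`/`hG34`: the statements of `SelmerDual.stub_selmerDualOdd_holds` /
`TameClass.stub_stepsTwoFourOdd_holds`. [cite: Kato2004Asterisque, §13.3, §13.8 (pp. 228–229) and Thm. 12.4 (p. 221)]
[cite: MazurRubin2004, Prop. 1.3.2, §4.4, §5.3] [cite: MilneADT2006, Ch. I, Thm. 2.8 and Thm. 4.10(b)] -/
theorem coreOdd_anyReduction_of_selmerDual_of_stepsTwoFour (hred : mem_pSmul_of_red_eq_zero)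
    (hPT : poitouTate_sum_localTatePairing_eq_zero ℚ)
    (hEP : ∀ v : HeightOneSpectrum (𝓞 ℚ), localEulerPoincareCharacteristic (v.adicCompletion ℚ))
    (hG1 :     ∀ (W : WeierstrassCurve ℚ) [W.IsElliptic] [W.IsGloballyMinimal] (p : ℕ) [Fact p.Prime]
      (κ : ZpExtension ℚ p) (γ : absoluteGaloisGroup ℚ),
      p ≠ 2 → W.HasIrreducibleModPGaloisRep p → ¬ W.HasSurjectiveModNGaloisRep p →
      κ.IsCyclotomic → κ.IsTopGenerator γ →
      (∀ v : HeightOneSpectrum (𝓞 ℚ), localEulerPoincareCharacteristic (v.adicCompletion ℚ)) →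
      poitouTate_sum_localTatePairing_eq_zero ℚ →
      ∀ (S₀ : Set (HeightOneSpectrum (𝓞 ℚ))), S₀.Finite →
      ∃ (ε : ℕ) (S : Set (HeightOneSpectrum (𝓞 ℚ))), S.Finite ∧ S₀ ⊆ S ∧
        ∀ (J : ℕ) (y : Literature.NumberTheory.EllipticCurves.subgroupH1 κ.kerSubgroup
            (WeierstrassCurve.geomTorsion W (p : ℤ))),
          W.torsionToPrimaryH1Sub p κ.kerSubgroup y ∈ W.fineSelmerInfty κ →
          (⇑(Literature.NumberTheory.EllipticCurves.conjH1 κ.kerSubgroup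
              (WeierstrassCurve.geomTorsion W (p : ℤ)) γ -
            AddMonoidHom.id (Literature.NumberTheory.EllipticCurves.subgroupH1 κ.kerSubgroup
              (WeierstrassCurve.geomTorsion W (p : ℤ)))))^[J] y ≠ 0 →
          ∃ Ψ : galoisCohomology (W.modPTwist p κ.invTwist (J + 1)) 1,
            (κ.invTwist.shiftH1 (W.torsionGaloisModule (p : ℤ))
                (fun P : WeierstrassCurve.geomTorsion W (p : ℤ) => AddSubgroup.torsionBy.nsmul P)
                (J + 1))^[J] Ψ ≠ 0 ∧
            (∀ v : HeightOneSpectrum (𝓞 ℚ), v ∉ S →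
              galoisCohomology.localization (W.modPTwist p κ.invTwist (J + 1)) (Sum.inr v) 1 Ψ ∈
                DiscreteGaloisModule.unramifiedSubgroup
                  (GaloisRep.toLocal v (W.modPTwist p κ.invTwist (J + 1))) 1) ∧
            (∀ v : HeightOneSpectrum (𝓞 ℚ), v ∈ S →
              galoisCohomology.localization (W.modPTwist p κ.invTwist (J + 1)) (Sum.inr v) 1
                ((κ.invTwist.shiftH1 (W.torsionGaloisModule (p : ℤ))
                  (fun P : WeierstrassCurve.geomTorsion W (p : ℤ) => AddSubgroup.torsionBy.nsmul P)
                  (J + 1))^[ε] Ψ) = 0))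
    (hG34 :     ∀ (W : WeierstrassCurve ℚ) [W.IsElliptic] [W.IsGloballyMinimal] (p : ℕ) [Fact p.Prime]
      [ContinuousSMul ℤ_[p] (W.tateModule p)] [Module.Free ℤ_[p] (W.tateModule p)]
      [Module.Finite ℤ_[p] (W.tateModule p)]
      (κ : ZpExtension ℚ p) (γ : absoluteGaloisGroup ℚ) (I : IwasawaH1Data W p κ γ),
      p ≠ 2 → W.HasIrreducibleModPGaloisRep p → ¬ W.HasSurjectiveModNGaloisRep p →
      κ.IsCyclotomic → κ.IsTopGenerator γ →
      poitouTate_sum_localTatePairing_eq_zero ℚ →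
      ∀ (s : I.H), IsEulerSystemClass W p κ γ I s →
      ∃ (S₀ : Set (HeightOneSpectrum (𝓞 ℚ))), S₀.Finite ∧
        ∀ (a : ℕ) (κ' : κ.twistTower (W.torsionGaloisModule (p : ℤ))
            (fun P : WeierstrassCurve.geomTorsion W (p : ℤ) => AddSubgroup.torsionBy.nsmul P)),
          (κ.towerShift (W.torsionGaloisModule (p : ℤ))
              (fun P : WeierstrassCurve.geomTorsion W (p : ℤ) => AddSubgroup.torsionBy.nsmul P))^[a]
            κ' = I.redTower s →
          ∀ (n e' : ℕ), e' + 1 = p ^ n →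
          ∀ (Φ : contOneCocycles (W.modPTwist p κ (2 * e' + 1 + 1)).toTopRep),
            oneCocycleClass (W.modPTwist p κ (2 * e' + 1 + 1)).toTopRep Φ = κ'.1 (2 * e' + 1 + 1) →
          ∀ (ε : ℕ) (S₁ : Set (HeightOneSpectrum (𝓞 ℚ)))
            (Ψ : galoisCohomology (W.modPTwist p κ.invTwist (2 * e' + 1 + 1)) 1)
            (Ψc : contOneCocycles (W.modPTwist p κ.invTwist (2 * e' + 1 + 1)).toTopRep),
            S₀ ⊆ S₁ →
            oneCocycleClass (W.modPTwist p κ.invTwist (2 * e' + 1 + 1)).toTopRep Ψc = Ψ →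
            (∀ v : HeightOneSpectrum (𝓞 ℚ), v ∉ S₁ →
              galoisCohomology.localization (W.modPTwist p κ.invTwist (2 * e' + 1 + 1)) (Sum.inr v) 1
                  Ψ ∈
                DiscreteGaloisModule.unramifiedSubgroup
                  (GaloisRep.toLocal v (W.modPTwist p κ.invTwist (2 * e' + 1 + 1))) 1) →
            (∀ v : HeightOneSpectrum (𝓞 ℚ), v ∈ S₁ →
              galoisCohomology.localization (W.modPTwist p κ.invTwist (2 * e' + 1 + 1)) (Sum.inr v) 1
                ((κ.invTwist.shiftH1 (W.torsionGaloisModule (p : ℤ))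
                  (fun P : WeierstrassCurve.geomTorsion W (p : ℤ) => AddSubgroup.torsionBy.nsmul P)
                  (2 * e' + 1 + 1))^[ε] Ψ) = 0) →
          ∀ (eW : WeierstrassCurve.geomTorsion W (p : ℤ) → WeierstrassCurve.geomTorsion W (p : ℤ) →
              AlgebraicClosure ℚ)
            (hμ : ∀ S T, eW S T ^ p = 1)
            (hadd₁ : ∀ S₁' S₂' T, eW (S₁' + S₂') T = eW S₁' T * eW S₂' T)
            (hadd₂ : ∀ S T₁ T₂, eW S (T₁ + T₂) = eW S T₁ * eW S T₂),
            (∀ T, eW T T = 1) → (∀ T, (∀ S, eW S T = 1) → T = 0) →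
            (∀ (σ : absoluteGaloisGroup ℚ) (S T : WeierstrassCurve.geomTorsion W (p : ℤ)),
              σ • eW S T = eW (σ • S) (σ • T)) →
          ∀ (q : HeightOneSpectrum (𝓞 ℚ)), q ∉ S₁ →
          ∀ 𝔓 ∈ q.primesAbove, ∀ (Fr : absoluteGaloisGroup ℚ), IsArithFrobAt (𝓞 ℚ) Fr 𝔓 →
            WeierstrassCurve.galoisRepTorsion W p Fr = 1 →
            Fr ∈ κ.layerSubgroup n → Fr ∉ κ.layerSubgroup (n + 1) →
          ∃ U : Polynomial ℤ, ¬ ((p : ℤ) ∣ U.coeff 0) ∧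
            ∀ i : ℕ, i + ε < 2 * e' + 1 + 1 →
              convCoeff (weilPairingHom W p eW hμ hadd₁ hadd₂) (2 * e' + 1 + 1) i
                (Polynomial.aeval (shiftEnd (WeierstrassCurve.geomTorsion W (p : ℤ)) (2 * e' + 1 + 1)) U
                  ((shiftEnd (WeierstrassCurve.geomTorsion W (p : ℤ)) (2 * e' + 1 + 1) ^ (e' + 1 + a))
                    (Φ.1 Fr)))
                (Ψc.1 Fr) = 0) :
    ∀ (W : WeierstrassCurve ℚ) [W.IsElliptic] [W.IsGloballyMinimal] (p : ℕ) [Fact p.Prime]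
      [ContinuousSMul ℤ_[p] (W.tateModule p)] [Module.Free ℤ_[p] (W.tateModule p)]
      [Module.Finite ℤ_[p] (W.tateModule p)]
      (κ : ZpExtension ℚ p) (γ : absoluteGaloisGroup ℚ) (I : IwasawaH1Data W p κ γ),
      p ≠ 2 → W.HasIrreducibleModPGaloisRep p → ¬ W.HasSurjectiveModNGaloisRep (p : ℤ) →
      κ.IsCyclotomic → κ.IsTopGenerator γ →
      (∃ s : I.H, IsEulerSystemClass W p κ γ I s ∧
        s ∉ IwasawaAlgebra.augIdealP p • (⊤ : Submodule (IwasawaAlgebra p) I.H)) →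
      ∃ J : ℕ, ∀ y : Literature.NumberTheory.EllipticCurves.subgroupH1 κ.kerSubgroup
          (WeierstrassCurve.geomTorsion W (p : ℤ)),
        W.torsionToPrimaryH1Sub p κ.kerSubgroup y ∈ W.fineSelmerInfty κ →
          (⇑(Literature.NumberTheory.EllipticCurves.conjH1 κ.kerSubgroup
              (WeierstrassCurve.geomTorsion W (p : ℤ)) γ -
            AddMonoidHom.id (Literature.NumberTheory.EllipticCurves.subgroupH1 κ.kerSubgroup
              (WeierstrassCurve.geomTorsion W (p : ℤ)))))^[J] y = 0 := by
  intro W _ _ p _ _ _ _ κ γ I hp2 hirr hns hκ hγ hs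
  obtain ⟨s, hES, hsp⟩ := hs
  have hp : p.Prime := Fact.out
  haveI : Finite (WeierstrassCurve.geomTorsion W (p : ℤ)) :=
    WeierstrassCurve.finite_torsionPoints_holds W (AlgebraicClosure ℚ) (by exact_mod_cast hp.ne_zero)
  -- STEP 0: `red_Ω s = T^a κ'`, `κ' ∉ T𝐇¹_Ω`, `κ̄' ≠ 0`
  have ht : I.redTower s ≠ 0 := I.redTower_ne_zero_of_not_mem hred hκ hγ hsp
  obtain ⟨a, κ', hκ'a, -, hκ'c⟩ :=
    LevelE.exists_towerShift_iterate_eq_and_towerConst_ne_zero W p κ hirr ht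
  -- Steps 3–4: the bad set `S₀` of the Euler system
  obtain ⟨S₀, hS₀, hG34⟩ :=
    hG34 W p κ γ I hp2 hirr hns hκ hγ hPT s hES
  -- the Selmer side: `ε`, `S₁ ⊇ S₀`
  obtain ⟨ε, S₁, hS₁, hS₀₁, hG1⟩ :=
    hG1 W p κ γ hp2 hirr hns hκ hγ hEP hPT S₀ hS₀
  -- a Weil pairing on `E[p]` and `μ_p ≃ ℤ/p`
  obtain ⟨eW, hμ, hadd₁, hadd₂, halt, hnondeg, hgal⟩ :=
    W.exists_weilPairing_holds p hp.two_le (Nat.cast_ne_zero.mpr hp.ne_zero)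
  -- suppose the conclusion fails: classes of arbitrarily large `T`-order
  by_contra hcon
  push Not at hcon
  -- the level `e = e' + 1 = p^n ≥ a + ε + 3`
  set n : ℕ := a + ε + 2 with hn
  have hlt : a + ε + 2 < p ^ n := Nat.lt_pow_self hp.one_lt
  obtain ⟨e', he⟩ : ∃ e' : ℕ, e' + 1 = p ^ n := ⟨p ^ n - 1, by omega⟩
  have he1 : 1 < e' + 1 := by
    have : p ≤ p ^ n := Nat.le_self_pow (by omega) p
    have := hp.two_le
    omega
  -- the bad class `y` with `T^{2e−1} y ≠ 0` and the dual class `Ψ` at level `2e`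
  obtain ⟨y, hy, hyT⟩ := hcon (2 * e' + 1)
  obtain ⟨Ψ, hΨT, hΨur, hΨε⟩ := hG1 (2 * e' + 1) y hy hyT
  obtain ⟨Ψc, hΨc⟩ := oneCocycleClass_surjective _ Ψ
  subst hΨc
  -- a cocycle `Φ` of `κ'_{2e}`
  obtain ⟨Φ, hΦ⟩ := oneCocycleClass_surjective _ (κ'.1 (2 * e' + 1 + 1))
  -- truncations to level `e = e' + 1`
  have hle : e' + 1 ≤ 2 * e' + 1 + 1 := by omega
  set φ : contOneCocycles (W.modPTwist p κ (e' + 1)).toTopRep :=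
    κ.pushCocycle (W.torsionGaloisModule (p : ℤ))
      (fun P : WeierstrassCurve.geomTorsion W (p : ℤ) => AddSubgroup.torsionBy.nsmul P) (2 * e' + 1 + 1)
      (κ.twistModPTruncate (W.torsionGaloisModule (p : ℤ)) _ (2 * e' + 1 + 1) hle) Φ with hφdef
  set ψ : contOneCocycles (W.modPTwist p κ.invTwist (e' + 1)).toTopRep :=
    κ.invTwist.pushCocycle (W.torsionGaloisModule (p : ℤ))
      (fun P : WeierstrassCurve.geomTorsion W (p : ℤ) => AddSubgroup.torsionBy.nsmul P) (2 * e' + 1 + 1)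
      (κ.invTwist.twistModPTruncate (W.torsionGaloisModule (p : ℤ)) _ (2 * e' + 1 + 1) hle) Ψc
    with hψdef
  have hφ : oneCocycleClass (W.modPTwist p κ (e' + 1)).toTopRep φ = κ'.1 (e' + 1) := by
    have h1 := (κ.mem_twistTower_iff (W.torsionGaloisModule (p : ℤ)) _ κ'.1).1 κ'.2 _ _ hle
    rw [← hΦ] at h1
    exact (ZpExtension.map_oneCocycleClass_twist κ (W.torsionGaloisModule (p : ℤ)) _ (2 * e' + 1 + 1)
      (κ.twistModPTruncate (W.torsionGaloisModule (p : ℤ)) _ (2 * e' + 1 + 1) hle) Φ).symm.trans h1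
  have hψT : (κ.invTwist.shiftH1 (W.torsionGaloisModule (p : ℤ))
      (fun P : WeierstrassCurve.geomTorsion W (p : ℤ) => AddSubgroup.torsionBy.nsmul P) (e' + 1))^[e']
        (oneCocycleClass (W.modPTwist p κ.invTwist (e' + 1)).toTopRep ψ) ≠ 0 :=
    shiftH1_iterate_truncate_ne_zero κ.invTwist (W.torsionGaloisModule (p : ℤ)) _ e' Ψc hΨT hle
  -- STEP 1 + LEMMA 4: a joint value `z` of `(φ, ψ)` whose two lowest pairing coefficients do not both vanish
  haveI : NeZero p := ⟨hp.ne_zero⟩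
  obtain ⟨z, hzMj, hz01⟩ := exists_jointValue_weil_ne_zero_of_ne_two W p κ hp2 hirr hns hγ
    κ' hκ'c he1 φ hφ ψ hψT eW hμ hadd₁ hadd₂ hnondeg
  -- STEP 2 (x9 g43): an `E`-split prime `q ∉ S₁` of depth `n` with a Frobenius realising `z`
  obtain ⟨N, -, -, -, -, -, -, q, hq, -, 𝔓, h𝔓, Fr, hFr, -, hφFr, hψFr, hFr1, hFrn, hFrn1⟩ :=
    exists_isArithFrobAt_mem_inf_ker_apply_eq_and_depth_of_ne_two W p κ hp2 hirr hns
      (J := e' + 1) (J' := e' + 1) (n := n) (by omega) he.le he.le φ ψ hzMj S₁ hS₁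
  -- STEPS 3–4 (stub): the Kolyvagin class and reciprocity at `q`
  obtain ⟨U, hU0, hrec⟩ := hG34 a κ' hκ'a n e' he Φ hΦ ε S₁ _ Ψc hS₀₁ rfl hΨur hΨε eW hμ hadd₁ hadd₂
    halt hnondeg hgal q hq 𝔓 h𝔓 Fr hFr hFr1 hFrn hFrn1
  -- the count: `C_0 = C_1 = 0` for the level-`2e` pair `(Φ(Fr), Ψc(Fr))`
  have hpC : ∀ c : DiscreteGaloisModule.MuCarrier ℚ p, (p : ℤ) • c = 0 :=
    natCast_zsmul_muCarrier_eq_zero ℚ p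
  obtain ⟨hC0, hC1⟩ := convCoeff_zero_one_eq_zero_of_reciprocity (weilPairingHom W p eW hμ hadd₁ hadd₂) hp hpC
    (m := e' + 1 + a) (ε := ε) (by omega) U hU0 (Φ.1 Fr) (Ψc.1 Fr) hrec
  -- the two lowest coefficients of the level-`2e` pair are those of `z` (truncation is definitional)
  have hk10 : Φ.1 Fr ⟨0, by omega⟩ = z.1 ⟨0, by omega⟩ := by rw [← hφFr]; rfl
  have hk11 : Φ.1 Fr ⟨1, by omega⟩ = z.1 ⟨1, he1⟩ := by rw [← hφFr]; rfl
  have hcy0 : Ψc.1 Fr ⟨0, by omega⟩ = z.2 ⟨0, by omega⟩ := by rw [← hψFr]; rfl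
  have hcy1 : Ψc.1 Fr ⟨1, by omega⟩ = z.2 ⟨1, he1⟩ := by rw [← hψFr]; rfl
  rw [convCoeff_zero_eq _ (by omega), hk10, hcy0] at hC0
  rw [convCoeff_one_eq _ (by omega), hk10, hcy1, hk11, hcy0] at hC1
  -- contradiction with the valuation `≤ 1` of `z`
  rcases hz01 with h0 | h1
  · exact h0 hC0
  · exact h1 hC1

/-- **The reduction-free core HOLDS**: for every globally minimal elliptic `W/ℚ`, every ODD prime `p` — good,
multiplicative or additive —, `E[p]` irreducible, `ρ̄_{E,p}` NOT onto, every cyclotomic `(κ, γ)` and pin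
`I = 𝐇¹_Γ(T_pW)`: a genuine `Λ`-adic Euler-system class `s ∉ p𝐇¹` yields `J` with `(conj_γ − 1)^J` killing every
`E[p]`-class lifting into `Sel₀(ℚ_∞, E[p^∞])`. The five inputs of
`coreOdd_anyReduction_of_selmerDual_of_stepsTwoFour` are tree theorems: Kato §13.8 in the weak-Lemma-8.5 (2) form
(`Kato2004.mem_pSmul_of_red_eq_zero_of_integral_of_smul_mem` ∘ `UniversalNorms.mem_integralH1_of_layerCores_eq_of_smul_mem`,
lur-a g2 ∕ k6-g4 g2), Poitou–Tate over `ℚ` (`poitouTate_sum_localTatePairing_eq_zero_holds`, bsd-cn100), the local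
Euler–Poincaré characteristic (`GaloisImage.EP.forall_localEulerPoincareCharacteristic_adicCompletion`), and the two
K6 stubs `SelmerDual.stub_selmerDualOdd_holds` (p465845), `TameClass.stub_stepsTwoFourOdd_holds` (koly g9 p474398) —
exactly as in `X10.coreTheoremAOddPrime_holds` (b2b x10 GEN 40). Unconditional.
[cite: Kato2004Asterisque, §13.8 (pp. 228–229) with Lemma 8.5 (2) (p. 183), Thm. 12.6 (p. 222)]
[cite: MilneADT2006, Ch. I, Thm. 4.10(b)] -/
theorem coreOdd_anyReduction_holds :
    ∀ (W : WeierstrassCurve ℚ) [W.IsElliptic] [W.IsGloballyMinimal] (p : ℕ) [Fact p.Prime]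
      [ContinuousSMul ℤ_[p] (W.tateModule p)] [Module.Free ℤ_[p] (W.tateModule p)]
      [Module.Finite ℤ_[p] (W.tateModule p)]
      (κ : ZpExtension ℚ p) (γ : absoluteGaloisGroup ℚ) (I : IwasawaH1Data W p κ γ),
      p ≠ 2 → W.HasIrreducibleModPGaloisRep p → ¬ W.HasSurjectiveModNGaloisRep (p : ℤ) →
      κ.IsCyclotomic → κ.IsTopGenerator γ →
      (∃ s : I.H, IsEulerSystemClass W p κ γ I s ∧
        s ∉ IwasawaAlgebra.augIdealP p • (⊤ : Submodule (IwasawaAlgebra p) I.H)) →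
      ∃ J : ℕ, ∀ y : Literature.NumberTheory.EllipticCurves.subgroupH1 κ.kerSubgroup
          (WeierstrassCurve.geomTorsion W (p : ℤ)),
        W.torsionToPrimaryH1Sub p κ.kerSubgroup y ∈ W.fineSelmerInfty κ →
          (⇑(Literature.NumberTheory.EllipticCurves.conjH1 κ.kerSubgroup
              (WeierstrassCurve.geomTorsion W (p : ℤ)) γ -
            AddMonoidHom.id (Literature.NumberTheory.EllipticCurves.subgroupH1 κ.kerSubgroup
              (WeierstrassCurve.geomTorsion W (p : ℤ)))))^[J] y = 0 :=
  coreOdd_anyReduction_of_selmerDual_of_stepsTwoFour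
    (mem_pSmul_of_red_eq_zero_of_integral_of_smul_mem fun W _ p _ _ κ hκ z hz hpz n =>
      UniversalNorms.mem_integralH1_of_layerCores_eq_of_smul_mem W p κ hκ z hz hpz n)
    (poitouTate_sum_localTatePairing_eq_zero_holds ℚ)
    (Summit.BirchSwinnertonDyer.Rank1Residual.GaloisImage.EP.forall_localEulerPoincareCharacteristic_adicCompletion ℚ)
    SelmerDual.stub_selmerDualOdd_holds TameClass.stub_stepsTwoFourOdd_holds

end Summit.BirchSwinnertonDyer.BirchSwinnertonDyer.Rank1Residual.CoreAssembly

end
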